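/-
Copyright (c) 2026. All rights reserved.
Released under Apache 2.0 license as described in the file LICENSE.
Authors: abc-iut cell, prover seat abc-iut-rp-x2 (branch B → R-H hand, gen 5).
-/
import Literature.IUT.LogVolume.UnitLogUnramifiedUnitPart
import HarnessLib

/-!
# The digit lemma, finitary form: the `n = 1` term as second scale, and the two core rows `(7, 11)` / `(7, 13)`

Proof-only sequel (theorems, no definitions, no named fact) of `UnitLogUnramifiedUnitPart.lean` (the «digit
lemma» `not_mem_logUnits_of_unramifiedUnitPart`: an element `ϖˢ·ω` whose unit part `ω` lies in an unramified part
`A ∋ ϖ^e/p` is not a `log_p` of a unit when `s = i₀·p − e` is the `p`-th-term exponent at a level `i₀` whose second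
scale `s₂` satisfies `s < s₂ < s + min(p, e)`).  Here:

* §1 `secondScale_one_of_checks`: FOUR INTEGER INEQUALITIES (`i₀ ≥ 1`, `h(2) = i₀p² − 2e ≥ i₀ + 1`,
  `(i₀p − e) + i₀p ≥ i₀ + 1`, `e ≤ i₀p(p−1)`) ⇒ the `n = 1` term is the second scale at level `i₀` (`s₂ = i₀`), i.e.
  every index `∉ {1, p}` has exponent `≥ i₀ + 1` — by the prime-power decomposition of the index
  (`exists_eq_pow_mul_and_not_dvd`) and abc-iut-w5-d017's `exponent_succ_le_add`;
* §2 `not_mem_logUnits_of_unramifiedUnitPart_checks` (the digit lemma with these checks; levels below `i₀` tie-free)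
  and `…_of_not_dvd` (`(p − 1) ∤ e`: no tie check);
* §3 the two PARAMETER ROWS of the abc-iut R-H table's «OPEN-element» core cells, read in the core field with
  `e ∈ {11, 13}` over `p = 7` (record only; the consumer is the datum-class writer, composing with abc-iut-H-num-1's
  `UnitLogDescent`): `core_seven_eleven_not_mem_logUnits` (`(i₀, s) = (1, −4)`: `ϖ⁻⁴·ω ∉ log₇ 𝒪^×`) and
  `core_seven_thirteen_not_mem_logUnits` (`(i₀, s) = (2, 1)`: `ϖ·ω ∉ log₇ 𝒪^×`) — for ANY `K/ℚ₇` of that index, any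
  norm uniformizer `ϖ`, any unramified part `A ∋ ϖ^e/7`, any unit `ω ∈ A`; both exponents ARE spectrum values
  (`N(1) = −4`, `N(2) = 1`), so no norm criterion decides them.

Classical `p`-adic analysis (Neukirch, *Algebraic Number Theory* II (5.5)).  Nothing here is disputed mathematics;
no IUT statement is asserted; nothing bears on [IUTchIII] Cor. 3.12.
-/

noncomputable section

open Metric Set

namespace Literature.IUT.LogVolume

namespace ValuationProfile

open Literature.NumberTheory.GaloisRepresentations.Ultrametric RamificationCriterion LogEnvelope

/-! ### §1. Arithmetic: when the `n = 1` term is the second scale -/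

section Arith

variable {p : ℕ} [hp : Fact p.Prime]

/-- **FINITE CHECKS for «the `n = 1` term is the SECOND scale at level `i₀`»**: if `i₀ ≥ 1`,
`h(2) = i₀·p² − 2e ≥ i₀ + 1`, the index-`2p` bound `(i₀·p − e) + i₀·p ≥ i₀ + 1`, and the turning inequality
`e ≤ i₀·p·(p−1)`, then EVERY index `n + 1 ∉ {1, p}` has exponent `i₀·(n+1) − e·v_p(n+1) ≥ i₀ + 1`
(indices prime to `p`: `≥ 2·i₀`; `p·m`, `m ≥ 2`: `≥ (i₀p − e) + i₀p`; `pᵃ·m`, `a ≥ 2`: `≥ h(a) ≥ h(2)`).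
[cite: NeukirchANT1999, Ch. II (5.5)] -/
theorem secondScale_one_of_checks {i₀ : ℤ} (hi₀ : 1 ≤ i₀) {e : ℕ}
    (h2 : i₀ + 1 ≤ i₀ * (p : ℤ) ^ 2 - (e : ℤ) * 2)
    (h2p : i₀ + 1 ≤ (i₀ * (p : ℤ) - e) + i₀ * (p : ℤ))
    (hturn : (e : ℤ) ≤ i₀ * (p : ℤ) * ((p : ℤ) - 1))
    (n : ℕ) (hnp : n + 1 ≠ p) (hn1 : n ≠ 0) :
    i₀ + 1 ≤ i₀ * ((n + 1 : ℕ) : ℤ) - (e : ℤ) * (padicValNat p (n + 1) : ℤ) := by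
  have hP : (2 : ℤ) ≤ (p : ℤ) := by exact_mod_cast hp.out.two_le
  obtain ⟨a, m, hm, hnm⟩ := Nat.exists_eq_pow_mul_and_not_dvd (show n + 1 ≠ 0 by omega) p hp.out.ne_one
  have hm1 : 1 ≤ m := Nat.one_le_iff_ne_zero.mpr (by rintro rfl; exact hm (dvd_zero p))
  rw [hnm, padicValNat_prime_pow_mul hm]
  have hkey : i₀ * ((p ^ a * m : ℕ) : ℤ) - (e : ℤ) * (a : ℤ)
      = (i₀ * (p : ℤ) ^ a - (e : ℤ) * (a : ℤ)) + i₀ * (p : ℤ) ^ a * ((m : ℤ) - 1) := by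
    push_cast
    ring
  rw [hkey]
  have hpa : (1 : ℤ) ≤ (p : ℤ) ^ a := by exact_mod_cast Nat.one_le_pow _ _ hp.out.pos
  have hm0 : (0 : ℤ) ≤ (m : ℤ) - 1 := by
    have : (1 : ℤ) ≤ m := by exact_mod_cast hm1
    linarith
  have htail : 0 ≤ i₀ * (p : ℤ) ^ a * ((m : ℤ) - 1) := mul_nonneg (by nlinarith) hm0
  rcases Nat.lt_or_ge a 1 with ha | ha
  · -- `a = 0`: the index is `m ≥ 2`, exponent `i₀·m ≥ 2·i₀`
    have ha0 : a = 0 := by omega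
    subst ha0
    have hm2 : (2 : ℤ) ≤ m := by
      have : m ≠ 1 := by
        rintro rfl
        exact hn1 (by simpa using hnm)
      exact_mod_cast (show 2 ≤ m by omega)
    simp only [pow_zero, Nat.cast_zero, mul_zero, sub_zero, mul_one]
    nlinarith
  rcases Nat.lt_or_ge a 2 with ha2 | ha2
  · -- `a = 1`: `m ≠ 1` (else the index is `p`), exponent `≥ (i₀p − e) + i₀p`
    have ha1 : a = 1 := by omega
    subst ha1
    have hm2 : (2 : ℤ) ≤ m := by
      have : m ≠ 1 := by
        rintro rfl
        exact hnp (by simpa using hnm)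
      exact_mod_cast (show 2 ≤ m by omega)
    rw [pow_one, Nat.cast_one, mul_one]
    have : i₀ * (p : ℤ) ≤ i₀ * (p : ℤ) * ((m : ℤ) - 1) := by nlinarith
    linarith
  · -- `a ≥ 2`: `h(a) ≥ h(2) ≥ i₀ + 1`
    obtain ⟨d, rfl⟩ := Nat.exists_eq_add_of_le ha2
    have hmono := exponent_succ_le_add (S := i₀) (P := (p : ℤ)) (E := (e : ℤ)) (a₀ := 1) hi₀ hP
      (by rw [pow_one]; exact hturn) d
    rw [show 1 + d + 1 = 2 + d from by ring] at hmono
    have h2' : i₀ + 1 ≤ i₀ * (p : ℤ) ^ (1 + 1) - (e : ℤ) * ((1 + 1 : ℕ) : ℤ) := by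
      norm_num
      linarith
    linarith

end Arith

/-! ### §2. The digit lemma with finite checks -/

section Field

variable (p : ℕ) [hp : Fact p.Prime]
variable {K : Type*} [NontriviallyNormedField K] [instK : NormedAlgebra ℚ_[p] K] [IsUltrametricDist K]
  [ProperSpace K]

/-- **DIGIT LEMMA, finitary form** (second scale = the `n = 1` term, `s₂ = i₀`): with `s = i₀·p − e`, the integer
checks `s < i₀ < s + min(p, e)`, `i₀ + 1 ≤ i₀·p² − 2e`, `i₀ + 1 ≤ s + i₀·p`, `e ≤ i₀·p·(p−1)`, and the levels below
`i₀` tie-free, `ϖˢ·ω ∉ log_p(𝒪_K^×)` for every unit `ω` of an unramified part `A ∋ ϖ^e/p`.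
[cite: NeukirchANT1999, Ch. II (5.5)] -/
theorem not_mem_logUnits_of_unramifiedUnitPart_checks {ϖ : Kˣ} (hϖ : IsUniformizer ϖ) (A : Subring K)
    (hA : ∀ z ∈ A, z ≠ 0 → ∃ k : ℤ, ‖z‖ = ‖(ϖ : K)‖ ^ ((absRamificationIdx p K : ℤ) * k))
    (hres : ∀ c : K, ‖c‖ ≤ 1 → ∃ c₀ ∈ A, ‖c - c₀‖ < 1)
    (hε : (ϖ : K) ^ absRamificationIdx p K / (p : K) ∈ A)
    {ω : K} (hωA : ω ∈ A) (hω : ‖ω‖ = 1)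
    {i₀ s : ℤ} (hi₀ : 1 ≤ i₀) (hs : i₀ * (p : ℤ) - (absRamificationIdx p K : ℤ) = s)
    (hlt : s < i₀) (hsp : i₀ < s + p) (hse : i₀ < s + absRamificationIdx p K)
    (h2 : i₀ + 1 ≤ i₀ * (p : ℤ) ^ 2 - (absRamificationIdx p K : ℤ) * 2)
    (h2p : i₀ + 1 ≤ s + i₀ * (p : ℤ))
    (hturn : (absRamificationIdx p K : ℤ) ≤ i₀ * (p : ℤ) * ((p : ℤ) - 1))
    (htie : ∀ i : ℤ, 1 ≤ i → i < i₀ → ∀ b : ℕ,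
      (absRamificationIdx p K : ℤ) ≠ i * (p : ℤ) ^ b * ((p : ℤ) - 1)) :
    (ϖ : K) ^ s * ω ∉ logUnits K := by
  refine not_mem_logUnits_of_unramifiedUnitPart p hϖ A hA hres hε hωA hω hs (n₁ := 0)
    (by have := hp.out.two_le; omega) ?_ ?_ hlt hsp hse htie
  · simp
  · intro n hnp hn1
    exact secondScale_one_of_checks hi₀ h2 (by rw [← hs] at h2p; linarith) hturn n hnp hn1

/-- **The blanket case**: for `(p − 1) ∤ e` every level is tie-free, so the finitary digit lemma needs no tie check.
[cite: NeukirchANT1999, Ch. II (5.5)] -/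
theorem not_mem_logUnits_of_unramifiedUnitPart_of_not_dvd (hnd : ¬ (p - 1) ∣ absRamificationIdx p K)
    {ϖ : Kˣ} (hϖ : IsUniformizer ϖ) (A : Subring K)
    (hA : ∀ z ∈ A, z ≠ 0 → ∃ k : ℤ, ‖z‖ = ‖(ϖ : K)‖ ^ ((absRamificationIdx p K : ℤ) * k))
    (hres : ∀ c : K, ‖c‖ ≤ 1 → ∃ c₀ ∈ A, ‖c - c₀‖ < 1)
    (hε : (ϖ : K) ^ absRamificationIdx p K / (p : K) ∈ A)
    {ω : K} (hωA : ω ∈ A) (hω : ‖ω‖ = 1)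
    {i₀ s : ℤ} (hi₀ : 1 ≤ i₀) (hs : i₀ * (p : ℤ) - (absRamificationIdx p K : ℤ) = s)
    (hlt : s < i₀) (hsp : i₀ < s + p) (hse : i₀ < s + absRamificationIdx p K)
    (h2 : i₀ + 1 ≤ i₀ * (p : ℤ) ^ 2 - (absRamificationIdx p K : ℤ) * 2)
    (h2p : i₀ + 1 ≤ s + i₀ * (p : ℤ))
    (hturn : (absRamificationIdx p K : ℤ) ≤ i₀ * (p : ℤ) * ((p : ℤ) - 1)) :
    (ϖ : K) ^ s * ω ∉ logUnits K :=
  not_mem_logUnits_of_unramifiedUnitPart_checks p hϖ A hA hres hε hωA hω hi₀ hs hlt hsp hse h2 h2p hturn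
    fun i hi1 hii b => tieFree_of_not_dvd p hnd (i₀ - 1) i hi1 (by omega) b

end Field

/-! ### §3. The two parameter rows of the abc-iut R-H «OPEN-element» core cells (record only) -/

section Rows

/-- **Core row `(p, e, i₀, s) = (7, 11, 1, −4)`** (the abc-iut R-H cells `HEX:1:11@p7.j4` and `HEX:5:11@p7.j2` read in
the core field `M'`, `e(M') = 11`): for ANY `K/ℚ₇` with `e = 11`, any norm uniformizer `ϖ`, any unramified part
`A ∋ ϖ¹¹/7` and any unit `ω ∈ A`, **`ϖ⁻⁴·ω ∉ log₇(𝒪_K^×)`** — although `−4 = N(1)` IS a spectrum value.  Checks: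
`s = 7 − 11 = −4 < 1 < 3 = s + 7`, `1 < 7 = s + e`, `h(2) = 49 − 22 = 27 ≥ 2`, `s + 7 = 3 ≥ 2`, `11 ≤ 42`; no level
below `i₀ = 1`. [cite: NeukirchANT1999, Ch. II (5.5)] [claim: Mochizuki2012, status: disputed] -/
theorem core_seven_eleven_not_mem_logUnits [Fact (Nat.Prime 7)] {K : Type*} [NontriviallyNormedField K]
    [NormedAlgebra ℚ_[7] K] [IsUltrametricDist K] [ProperSpace K] (he : absRamificationIdx 7 K = 11)
    {ϖ : Kˣ} (hϖ : IsUniformizer ϖ) (A : Subring K)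
    (hA : ∀ z ∈ A, z ≠ 0 → ∃ k : ℤ, ‖z‖ = ‖(ϖ : K)‖ ^ ((11 : ℤ) * k))
    (hres : ∀ c : K, ‖c‖ ≤ 1 → ∃ c₀ ∈ A, ‖c - c₀‖ < 1)
    (hε : (ϖ : K) ^ 11 / ((7 : ℕ) : K) ∈ A) {ω : K} (hωA : ω ∈ A) (hω : ‖ω‖ = 1) :
    (ϖ : K) ^ (-4 : ℤ) * ω ∉ logUnits K := by
  refine not_mem_logUnits_of_unramifiedUnitPart_checks 7 hϖ A (by rw [he]; exact_mod_cast hA) hres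
    (by rw [he]; exact hε) hωA hω (i₀ := 1) le_rfl ?_ ?_ ?_ ?_ ?_ ?_ ?_ ?_
  · rw [he]; norm_num
  · norm_num
  · norm_num
  · rw [he]; norm_num
  · rw [he]; norm_num
  · norm_num
  · rw [he]; norm_num
  · intro i hi1 hi2; omega

/-- **Core row `(p, e, i₀, s) = (7, 13, 2, 1)`** (the abc-iut R-H cell `HEX:4:13@p7.j2` read in the core field
`M'`, `e(M') = 13`): for ANY `K/ℚ₇` with `e = 13`, any norm uniformizer `ϖ`, any unramified part `A ∋ ϖ¹³/7` and any
unit `ω ∈ A`, **`ϖ·ω ∉ log₇(𝒪_K^×)`** — although `1 = N(2)` IS a spectrum value.  Checks: `s = 14 − 13 = 1 < 2 <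
8 = s + 7`, `2 < 14 = s + e`, `h(2) = 98 − 26 = 72 ≥ 3`, `s + 14 = 15 ≥ 3`, `13 ≤ 84`; level `1` tie-free
(`13 ∉ {6, 42, …}`). [cite: NeukirchANT1999, Ch. II (5.5)] [claim: Mochizuki2012, status: disputed] -/
theorem core_seven_thirteen_not_mem_logUnits [Fact (Nat.Prime 7)] {K : Type*} [NontriviallyNormedField K]
    [NormedAlgebra ℚ_[7] K] [IsUltrametricDist K] [ProperSpace K] (he : absRamificationIdx 7 K = 13)
    {ϖ : Kˣ} (hϖ : IsUniformizer ϖ) (A : Subring K)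
    (hA : ∀ z ∈ A, z ≠ 0 → ∃ k : ℤ, ‖z‖ = ‖(ϖ : K)‖ ^ ((13 : ℤ) * k))
    (hres : ∀ c : K, ‖c‖ ≤ 1 → ∃ c₀ ∈ A, ‖c - c₀‖ < 1)
    (hε : (ϖ : K) ^ 13 / ((7 : ℕ) : K) ∈ A) {ω : K} (hωA : ω ∈ A) (hω : ‖ω‖ = 1) :
    (ϖ : K) ^ (1 : ℤ) * ω ∉ logUnits K := by
  refine not_mem_logUnits_of_unramifiedUnitPart_checks 7 hϖ A (by rw [he]; exact_mod_cast hA) hres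
    (by rw [he]; exact hε) hωA hω (i₀ := 2) (by norm_num) ?_ ?_ ?_ ?_ ?_ ?_ ?_ ?_
  · rw [he]; norm_num
  · norm_num
  · norm_num
  · rw [he]; norm_num
  · rw [he]; norm_num
  · norm_num
  · rw [he]; norm_num
  · intro i hi1 hi2
    have hi : i = 1 := by omega
    subst hi
    rw [he]
    refine tieFree_of_lt 7 le_rfl (A := 1) (by norm_num) ?_
    intro a ha
    interval_cases a
    norm_num

end Rows

end ValuationProfile

end Literature.IUT.LogVolume

end
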